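import Summits.Ventures.LatticeQCDFlow.Exactness.ReversibleVariationalFloorThinned
import Summits.Ventures.LatticeQCDFlow.Exactness.ReversibleDirichletFloor
import Mathlib.Analysis.Complex.AbelLimit
import HarnessLib

/-!
# Every `τ_int` floor of the tree in ABEL FORM, unconditionally: `Σ_k ρ(Vk) rᵏ ≥ 1/((1 − r) + r V D/(2 C(0)))`, and the summability dichotomy

HONEST FRAMING: exact (Metropolis-corrected) sampling algorithms for lattice gauge theory;
figures of merit are autocorrelation/cost numbers at stated couplings and volumes; no
continuum-physics claim.  (SCALAR calibration rung S0-A: not a gauge result.)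

Venture `LatticeQCDFlow` (cell pub-lqcd), topic `Exactness`; FANOUT row 2 (`s0-phi4`).  NEW WORK
of the cell over `Exactness/ReversibleVariationalFloor.lean` (Madras–Slade in Abel form,
`RevOp.abelSum_autocorr_ge`), `ReversibleVariationalFloorThinned.lean` (`abelSum_nonneg`),
`ReversibleAutocovMonotone.lean` (`C(0) − C(V) ≤ V (C(0) − C(1))`), `ReversibleDirichletFloor.lean`
(`∫ Γ w ≤ D ⇒ C(0) − C(1) ≤ D/2`) and Mathlib's Abel limit theorem.  Nothing is cited as a fact.

## Why this file

Every critical-slowing-down floor of rows C/E/G/I/J/K of HOME/s0-phi4/CSD-THEOREMS.md and of the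
HMC / free-field companions has the shape "IF the (thinned) autocorrelation series of `g` is
summable and `ρ < 1` THEN `τ_int ≥ F − ½`", `F = 2 C(0)/(V D)` for a carré-du-champ bound
`∫ Γ w ≤ D`.  The hypothesis is not dischargeable for any run and is vacuous exactly for the worst
observables.  Here the same floors are stated for the ABEL SUMS `Σ_k ρ(Vk) rᵏ`, which exist for
every `r < 1` with no hypothesis at all; Abel's theorem then says: EITHER the series is not summable
(infinite `τ_int`), OR it is and `τ_int + ½ = lim_{r↑1} Σ_k ρ(Vk) rᵏ ≥ F`.  One file, format level
(`RevOp`), so that every lattice instance inherits it by citing its carré-du-champ bound.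

## What is proved (namespace `RevOp`; `g ∈ A`, `C(k) = ∫ g (Kᵏ g) w`, `C(0) > 0`, `ρ(k) = C(k)/C(0)`,
`0 ≤ r < 1`, `V` a number of elementary steps)

* **`thinned_abelSum_autocorr_ge`** — `Σ_{k≥0} ρ(Vk) rᵏ ≥ 1 / ((1 − r) + r V (1 − ρ(1)))`
  (Madras–Slade per `V` steps, Abel form; `V = 1` is `abelSum_autocorr_ge`);
* **`thinned_abelSum_autocorr_ge_of_integral_carre_le`** — with `1 ∈ A`, `K1 = 1`, `g² ∈ A` and
  `∫ K[(g − g(x))²](x) w ≤ D`:  `Σ_{k≥0} ρ(Vk) rᵏ ≥ 1 / ((1 − r) + r V D/(2 C(0)))`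
  — the Abel form of EVERY locality / msd / acceptance / energy floor of the tree (they are this
  statement with their respective `D`), free of the summability hypothesis; as `r ↑ 1` the bound is
  `2 C(0)/(V D) = floor + ½`;
* **`hasSum_autocorr_of_summable`** / **`tendsto_abelSum_autocorr`** — if the thinned series IS
  summable then `Σ_k ρ(Vk) rᵏ → τ_int^{(V)} + ½` as `r ↑ 1` (Abel), so every Abel-form floor passes
  to `τ_int`;  **`not_summable_of_abelSum_unbounded`** — if the Abel sums are unbounded as `r ↑ 1`
  the series is NOT summable (the dichotomy used by the no-spectral-gap files).

NOT CLAIMED: anything new about which alternative holds for a given sampler and observable.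
-/

namespace Summit.Ventures.LatticeQCDFlow.Exactness

open Real MeasureTheory Filter Finset Topology
open Summit.Ventures.LatticeQCDFlow.Scoring

namespace RevOp

variable {X : Type*} [MeasurableSpace X] {μ : Measure X} {w : X → ℝ} {A : (X → ℝ) → Prop}
  {K : (X → ℝ) → (X → ℝ)}

/-- **MADRAS–SLADE PER `V` STEPS, ABEL FORM (unconditional).**  For `g ∈ A` with `C(0) > 0` and
`0 ≤ r < 1`:  `Σ_{k≥0} ρ(Vk) rᵏ ≥ 1 / ((1 − r) + r V (1 − ρ(1)))`. -/
theorem thinned_abelSum_autocorr_ge (hw0 : ∀ x, 0 ≤ w x)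
    (hAi : ∀ ⦃f h : X → ℝ⦄, A f → A h → Integrable (fun x => f x * h x * w x) μ)
    (hAc : ∀ ⦃f h : X → ℝ⦄ (c : ℝ), A f → A h → A (fun x => f x + c * h x))
    (hAK : ∀ ⦃f : X → ℝ⦄, A f → A (K f))
    (hlin : ∀ ⦃f h : X → ℝ⦄ (c : ℝ), A f → A h →
      ∀ x, K (fun s => f s + c * h s) x = K f x + c * K h x)
    (hsymm : ∀ ⦃f h : X → ℝ⦄, A f → A h →
      ∫ x, K f x * h x * w x ∂μ = ∫ x, f x * K h x * w x ∂μ)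
    (hcontr : ∀ ⦃f : X → ℝ⦄, A f → ∫ x, K f x ^ 2 * w x ∂μ ≤ ∫ x, f x ^ 2 * w x ∂μ)
    {g : X → ℝ} (hg : A g) (hP : 0 < ∫ x, g x ^ 2 * w x ∂μ) (V : ℕ) {r : ℝ} (hr0 : 0 ≤ r)
    (hr1 : r < 1) :
    1 / ((1 - r) + r * (V * (1 - (∫ x, g x * K g x * w x ∂μ) / ∫ x, g x ^ 2 * w x ∂μ)))
      ≤ ∑' k, (∫ x, g x * (K^[V * k] g) x * w x ∂μ) / (∫ x, g x ^ 2 * w x ∂μ) * r ^ k := by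
  have hAK' : ∀ ⦃f : X → ℝ⦄, A f → A (K^[V] f) := fun f hf => iterate_mem hAK V hf
  have hlin' : ∀ ⦃f h : X → ℝ⦄ (c : ℝ), A f → A h →
      ∀ x, K^[V] (fun s => f s + c * h s) x = (K^[V] f) x + c * (K^[V] h) x :=
    fun f h c hf hh => iterate_add_mul hAK hlin c V hf hh
  have hsymm' : ∀ ⦃f h : X → ℝ⦄, A f → A h →
      ∫ x, (K^[V] f) x * h x * w x ∂μ = ∫ x, f x * (K^[V] h) x * w x ∂μ :=
    fun f h hf hh => iterate_symm hAK hsymm V hf hh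
  have hcontr' : ∀ ⦃f : X → ℝ⦄, A f → ∫ x, (K^[V] f) x ^ 2 * w x ∂μ ≤ ∫ x, f x ^ 2 * w x ∂μ :=
    fun f hf => iterate_contr hAK hcontr V hf
  have h := abelSum_autocorr_ge (K := K^[V]) hw0 hAi hAc hAK' hlin' hsymm' hcontr' hg hr0 hr1 hP
  simp only [← Function.iterate_mul] at h
  refine le_trans ?_ h
  -- `1 − r ρ(V) ≤ (1 − r) + r V (1 − ρ(1))` from `1 − ρ(V) ≤ V (1 − ρ(1))`
  set P := ∫ x, g x ^ 2 * w x ∂μ with hPdef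
  have hdef := one_sub_autocorr_le hw0 hAi hAc hAK hlin hsymm hcontr hg hP V
  have hCV : (∫ x, g x * (K^[V] g) x * w x ∂μ) / P ≤ 1 := by
    rw [div_le_one hP]
    have h1 := abs_autocov_le hw0 hAi hAK hcontr hg V
    exact (le_abs_self _).trans h1
  have hpos : 0 < 1 - r * ((∫ x, g x * (K^[V] g) x * w x ∂μ) / P) := by nlinarith
  exact one_div_le_one_div_of_le hpos (by nlinarith)

/-- **EVERY CARRÉ-DU-CHAMP FLOOR IN ABEL FORM (unconditional).**  With `1 ∈ A`, `K 1 = 1`,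
`g, g² ∈ A`, `C(0) > 0` and an integrated carré-du-champ bound `∫ K[(g − g(x))²](x) w ≤ D`:
for every `V` and `0 ≤ r < 1`,  `Σ_{k≥0} ρ(Vk) rᵏ ≥ 1 / ((1 − r) + r V D / (2 C(0)))`. -/
theorem thinned_abelSum_autocorr_ge_of_integral_carre_le (hw0 : ∀ x, 0 ≤ w x)
    (hA1 : A (fun _ => (1 : ℝ)))
    (hAi : ∀ ⦃f h : X → ℝ⦄, A f → A h → Integrable (fun x => f x * h x * w x) μ)
    (hAc : ∀ ⦃f h : X → ℝ⦄ (c : ℝ), A f → A h → A (fun x => f x + c * h x))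
    (hAK : ∀ ⦃f : X → ℝ⦄, A f → A (K f))
    (hlin : ∀ ⦃f h : X → ℝ⦄ (c : ℝ), A f → A h →
      ∀ x, K (fun s => f s + c * h s) x = K f x + c * K h x)
    (hsymm : ∀ ⦃f h : X → ℝ⦄, A f → A h →
      ∫ x, K f x * h x * w x ∂μ = ∫ x, f x * K h x * w x ∂μ)
    (hcontr : ∀ ⦃f : X → ℝ⦄, A f → ∫ x, K f x ^ 2 * w x ∂μ ≤ ∫ x, f x ^ 2 * w x ∂μ)
    (hunit : ∀ x, K (fun _ => (1 : ℝ)) x = 1)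
    {g : X → ℝ} (hg : A g) (hg2 : A (fun x => g x ^ 2)) (hP : 0 < ∫ x, g x ^ 2 * w x ∂μ) {D : ℝ}
    (hΓ : ∫ x, K (fun y => (g y - g x) ^ 2) x * w x ∂μ ≤ D) (V : ℕ) {r : ℝ} (hr0 : 0 ≤ r)
    (hr1 : r < 1) :
    1 / ((1 - r) + r * (V * (D / (2 * ∫ x, g x ^ 2 * w x ∂μ))))
      ≤ ∑' k, (∫ x, g x * (K^[V * k] g) x * w x ∂μ) / (∫ x, g x ^ 2 * w x ∂μ) * r ^ k := by
  have h := thinned_abelSum_autocorr_ge hw0 hAi hAc hAK hlin hsymm hcontr hg hP V hr0 hr1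
  refine le_trans ?_ h
  set P := ∫ x, g x ^ 2 * w x ∂μ with hPdef
  have hE := dirichlet_le_of_integral_carre_le hA1 hAi hAc hAK hlin hsymm hunit hg hg2 hΓ
  -- `1 − ρ(1) ≤ D/(2P)`
  have h1 : 1 - (∫ x, g x * K g x * w x ∂μ) / P ≤ D / (2 * P) := by
    rw [show 1 - (∫ x, g x * K g x * w x ∂μ) / P = (P - ∫ x, g x * K g x * w x ∂μ) / P by
      field_simp, div_le_div_iff₀ hP (by positivity)]
    nlinarith
  have hρ1 : (∫ x, g x * K g x * w x ∂μ) / P ≤ 1 := by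
    rw [div_le_one hP]
    have h1' := abs_autocov_le hw0 hAi hAK hcontr hg 1
    simp only [Function.iterate_one] at h1'
    exact (le_abs_self _).trans h1'
  have hpos : 0 < (1 - r) + r * (V * (1 - (∫ x, g x * K g x * w x ∂μ) / P)) := by
    have : 0 ≤ r * (V * (1 - (∫ x, g x * K g x * w x ∂μ) / P)) :=
      mul_nonneg hr0 (mul_nonneg (Nat.cast_nonneg V) (by linarith))
    linarith
  exact one_div_le_one_div_of_le hpos (by nlinarith [mul_nonneg hr0 (Nat.cast_nonneg V)])

/-! ## The summability dichotomy -/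

/-- **Abel's theorem for the autocorrelation series**: if the thinned normalised autocorrelation
series `k ↦ ρ(V(k+1))` is summable then the Abel sums converge to `τ_int^{(V)} + ½` as `r ↑ 1`. -/
theorem tendsto_abelSum_autocorr {C : ℕ → ℝ} {P : ℝ} (hC0 : C 0 = P) (hP : P ≠ 0)
    (hs : Summable fun k => C (k + 1) / P) :
    Tendsto (fun r : ℝ => ∑' k, C k / P * r ^ k) (𝓝[<] 1)
      (𝓝 (tauInt (fun k => C k / P) + 1 / 2)) := by
  have hsρ : Summable fun k => C k / P := (summable_nat_add_iff 1).1 hs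
  have habel : Tendsto (fun x : ℝ => ∑' k, C k / P * x ^ k) (𝓝[<] 1) (𝓝 (∑' k, C k / P)) :=
    Real.tendsto_tsum_powerSeries_nhdsWithin_lt hsρ.hasSum.tendsto_sum_nat
  have hsum : ∑' k, C k / P = tauInt (fun k => C k / P) + 1 / 2 := by
    rw [hsρ.tsum_eq_zero_add, hC0, div_self hP]
    simp only [tauInt]
    ring
  rw [← hsum]
  exact habel

/-- **From Abel-form floors to `τ_int` floors**: if the thinned series is summable and the Abel sums
are eventually `≥ F(r)` with `F(r) → L` as `r ↑ 1`, then `τ_int^{(V)} ≥ L − ½`. -/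
theorem tauInt_ge_of_abelSum_ge {C : ℕ → ℝ} {P : ℝ} (hC0 : C 0 = P) (hP : P ≠ 0)
    (hs : Summable fun k => C (k + 1) / P) {F : ℝ → ℝ} {L : ℝ}
    (hF : Tendsto F (𝓝[<] 1) (𝓝 L))
    (hge : ∀ᶠ r in 𝓝[<] (1 : ℝ), F r ≤ ∑' k, C k / P * r ^ k) :
    L - 1 / 2 ≤ tauInt (fun k => C k / P) := by
  have h := le_of_tendsto_of_tendsto hF (tendsto_abelSum_autocorr hC0 hP hs) hge
  linarith

/-- **THE DICHOTOMY**: if the Abel sums of the normalised autocorrelation series are unbounded as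
`r ↑ 1` (for every `L` there are `r < 1` arbitrarily close to `1` with `Σ_k ρ(k) rᵏ ≥ L`), then the
series is NOT summable — the integrated autocorrelation time is infinite. -/
theorem not_summable_of_abelSum_unbounded {C : ℕ → ℝ} {P : ℝ} (hC0 : C 0 = P) (hP : P ≠ 0)
    (hunb : ∀ L : ℝ, ∃ᶠ r in 𝓝[<] (1 : ℝ), L ≤ ∑' k, C k / P * r ^ k) :
    ¬ Summable fun k => C (k + 1) / P := by
  intro hs
  have ht := tendsto_abelSum_autocorr hC0 hP hs
  set T := tauInt (fun k => C k / P) + 1 / 2 with hT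
  -- eventually the Abel sums are `< T + 1`, contradicting unboundedness at `L = T + 1`
  have hev : ∀ᶠ r in 𝓝[<] (1 : ℝ), ∑' k, C k / P * r ^ k < T + 1 :=
    ht.eventually (Iio_mem_nhds (by linarith))
  obtain ⟨r, hr1, hr2⟩ := ((hunb (T + 1)).and_eventually hev).exists
  linarith

end RevOp

end Summit.Ventures.LatticeQCDFlow.Exactness
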